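import Literature.MathematicalPhysics.QuantumFieldTheory.Balaban1983to89.Node00.Carriers2
import Literature.MathematicalPhysics.QuantumFieldTheory.Balaban1983to89.Node00.CarriersB6
import Literature.MathematicalPhysics.QuantumFieldTheory.Balaban1983to89.Node00.CarriersB6K
import Literature.MathematicalPhysics.QuantumFieldTheory.Balaban1983to89.B6BlockParamOneLevel
import Literature.MathematicalPhysics.QuantumFieldTheory.Balaban1983to89.B6Prop25TwoScaleCensus

/-!
# NODE 00 (YM-PLAN Track A) — STAGE 3 OF THE WORLD-OF-RECORD CHAIN: the k-level tower block of record joins (`carriers₃ θ X :=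
# carriers₂ θ (withB6KOfRecord X θ)`), `IsWorldOfRecord₃ → IsWorldOfRecord₂ → IsWorldOfRecord₁`, and the DAG node N03 at every Stage-3 world
# MODULO the block's leaf (`b6_main_of_isWorldOfRecord₃_of`)

NODE 00 STAGE-3 MODULE (seat `pub-ymgap-node00-def` g27, 2026-08-25; design note `HOME/pub-ymgap-node00-def/STAGE3-SCOPING-g27.md`; the CONVENTIONS OF RECORD
block of the root module `Node00.Carriers` applies).  APPEND-ONLY GROWTH: a NEW importing module; no landed module edited.  It PINS the two index-independent
families that `Node00.towerBlockOfRecord` (module `Node00.CarriersB6K`) takes as parameters — the tree-gauge data of Lemma 2.4 := b06's `B6Lemma24Carrier.carrier`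
over all finite `Λ′ ⊂ Lℤ^{d+1}` (`treeOfRecord`), the local operators of Prop. 2.5 := the genuine two-scale family `G_□` of `B6Prop25TwoScaleCensus` (`locOfRecord`, the
choice of seat dag-p1) — and fixes the Stage-3 parameters `Stage3Params` (torus dimension `d₆ + 1 = D`, block size `ℓ₆ + 1 = L`, weight band `0 < b₀ ≤ b₁` of
(2.16), Lemma-2.1 rate `0 < δ₀ ≤ 2/L`).  The B6 group of `carriers₂` is `X.D6` untouched (`CarriersFrame.carriers₁_groupB6`), so substituting it inside is free.
HONEST FRAMING: definitions + kernel bookkeeping; Lemma 2.4 (printed constant) and Prop. 2.5 on the pinned carriers are the lineages' theorems BY NAME; the N03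
theorem here is MODULO the displayed leaf `DagBinding.B6BlockParam (D6OfRecord θ)` (dag-p1's discharge module + Prop. 2.6 hypothesis-free close it; species rule
R414 (B)(v)).  One finite T⁴ programme; NOT ℝ⁴ ∕ infinite volume ∕ OS ∕ mass gap ∕ Clay.
-/

noncomputable section

namespace Literature.MathematicalPhysics.QuantumFieldTheory.Balaban1983to89.Node00

open DagBinding
open B6Lemma24Carrier (carrier q1Of)
open B6Lemma24Printed (lemma24Printed_carrier)
open B6BlockParamOneLevel (TreeIdx)
open B6Prop25TwoScaleCensus (TSIdx prop25Printed_TS)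

/-! ## §1. The two index-independent families of record (Lemma 2.4, Prop. 2.5) -/

/-- **Tree-gauge data of record** (Lemma 2.4): all finite `Λ′ ⊂ Lℤ^{D}`, b06's carrier with `q₁` of (2.128) — the one-level knit's choice, index-independent.
[cite: Balaban1984PropagatorsII, Lemma 2.4 (2.121), (2.128) pp.244–245] -/
def treeOfRecord (D L : ℕ) : TreeIdx D L → B6.TreeData :=
  fun t => carrier L t.1 (q1Of L t.1)

/-- **Lemma 2.4 WITH THE PRINTED CONSTANT on the tree-gauge data of record** (b06's `lemma24Printed_carrier`, every `D ≥ 2`, `L ≥ 1`).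
[cite: Balaban1984PropagatorsII, Lemma 2.4 (2.128) p.245 (kernel version of the b2b b06 lineage)] -/
theorem lemma24_treeOfRecord {D L : ℕ} (hD : 2 ≤ D) (hL : 1 ≤ L) : B6.Lemma24Printed D (L : ℝ) (treeOfRecord D L) :=
  lemma24Printed_carrier hD hL (fun t : TreeIdx D L => t.1) fun t => t.2

/-- **Local operators of record** (Prop. 2.5): the genuine two-scale family `G_□` of (2.90) with weights in the band `[a₀, a₁]` (the choice of seat dag-p1).
[cite: Balaban1984PropagatorsII, (2.89)–(2.90) p.239, Prop. 2.5 p.246] -/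
def locOfRecord (d L : ℕ) (hd : 1 ≤ d + 1) (hL : Odd L ∧ 1 < L) (a₀ a₁ : ℝ) : TSIdx d L hd hL a₀ a₁ → B6.LocalOp :=
  fun t => t.locTS

/-- **Prop. 2.5 on the local operators of record** (`B6Prop25TwoScaleCensus.prop25Printed_TS`, by name).
[cite: Balaban1984PropagatorsII, Prop. 2.5 p.246 (kernel version of the lit-balaban lineage, two-scale family)] -/
theorem prop25_locOfRecord {d L : ℕ} {hd : 1 ≤ d + 1} {hL : Odd L ∧ 1 < L} {a₀ a₁ : ℝ} (ha₀ : 0 < a₀) (ha₁ : a₀ ≤ a₁) :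
    B6.Prop25Printed (locOfRecord d L hd hL a₀ a₁) :=
  prop25Printed_TS ha₀ ha₁

/-! ## §2. Stage-3 parameters and the block of record -/

/-- **Stage-3 family parameters**: the Stage-2 parameters and the [Balaban1984PropagatorsII] dictionary of the k-level family — torus dimension index `d₆`
(`d₆ + 1 = D`), block-size index `ℓ₆` (`ℓ₆ + 1 = L`), the weight band `0 < b₀ ≤ b₁` of (2.16), and the Lemma-2.1 rate `0 < δ₀ ≤ 2/L` (dag-p1's (2.59) reading).
[cite: Balaban1984PropagatorsII, (2.1)–(2.4) p.224, (2.16) p.225, (2.59) p.233 (parameter dictionary)] -/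
structure Stage3Params extends Stage2Params where
  /-- torus dimension index: the k-level family lives on `(d₆ + 1)`-dimensional tori -/
  d₆ : ℕ
  /-- block-size index: `L = ℓ₆ + 1` -/
  ℓ₆ : ℕ
  hd₆ : d₆ + 1 = D
  hℓ₆ : ℓ₆ + 1 = L
  /-- weight band of (2.16) -/
  b₀ : ℝ
  b₁ : ℝ
  hb : 0 < b₀ ∧ b₀ ≤ b₁
  /-- decay rate of Lemma 2.1 -/
  δ₀ : ℝ
  hδ₀ : 0 < δ₀ ∧ δ₀ ≤ 2 / ((ℓ₆ : ℝ) + 1)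

namespace Stage3Params

/-- `1 ≤ d₆ + 1`. [cite: Balaban1984PropagatorsII, (2.1) p.224, bookkeeping] -/
theorem hd' (θ : Stage3Params) : 1 ≤ θ.d₆ + 1 := Nat.succ_pos _

/-- `L = ℓ₆ + 1` is odd and `> 1`. [cite: Balaban1987RG1, p.253 («L an odd positive integer»), bookkeeping] -/
theorem hL' (θ : Stage3Params) : Odd (θ.ℓ₆ + 1) ∧ 1 < θ.ℓ₆ + 1 := by
  rw [θ.hℓ₆]; exact θ.hL

end Stage3Params

/-- **The B6 block data of record at `θ`**: the k-level tower block `towerBlockOfRecord` with the tree-gauge and local-operator families pinned.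
[cite: Balaban1984PropagatorsII, pp.223–250 (the carriers of the stated block)] -/
def D6OfRecord (θ : Stage3Params) : B6.BlockData :=
  towerBlockOfRecord θ.d₆ θ.ℓ₆ θ.hd' θ.hL' θ.b₀ θ.b₁ θ.δ₀ (treeOfRecord (θ.d₆ + 1) (θ.ℓ₆ + 1))
    (locOfRecord θ.d₆ (θ.ℓ₆ + 1) θ.hd' θ.hL' θ.b₀ θ.b₁)

/-- Lemma 2.4 holds for the block of record (printed constant; `d₆ ≥ 1`). [cite: Balaban1984PropagatorsII, Lemma 2.4 (2.128) p.245] -/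
theorem lemma24_D6OfRecord (θ : Stage3Params) (hd₆ : 1 ≤ θ.d₆) :
    B6.Lemma24Printed (D6OfRecord θ).d (D6OfRecord θ).L (D6OfRecord θ).tree :=
  lemma24_treeOfRecord (by show 2 ≤ θ.d₆ + 1; omega) (Nat.succ_pos _)

/-- Prop. 2.5 holds for the block of record. [cite: Balaban1984PropagatorsII, Prop. 2.5 p.246] -/
theorem prop25_D6OfRecord (θ : Stage3Params) : B6.Prop25Printed (D6OfRecord θ).loc :=
  prop25_locOfRecord θ.hb.1 θ.hb.2

/-! ## §3. The Stage-3 carrier bundle and world-of-record predicate -/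

/-- The carrier bundle `X` with its B6 block data := the block of record at `θ`. [cite: Balaban1984PropagatorsII, pp.223–250 (dictionary)] -/
def withB6KOfRecord (X : PrintedCarriersR) (θ : Stage3Params) : PrintedCarriersR :=
  withB6 X (D6OfRecord θ)

/-- **The Stage-3 carrier bundle of record**: the k-level B6 block substituted INSIDE the Stage-2 bundle (B4, B5, B7 groups of record).
[cite: Balaban1984PropagatorsII, pp.223–250; Balaban1985Averaging, Props. 1–10 pp.26–50; Balaban1983RegularityDecay, (1.1)–(1.7) pp.572–573; Balaban1984PropagatorsI, Props. 1.1–1.2 pp.33–36 (the lineages' concrete carriers)] -/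
def carriers₃ (θ : Stage3Params) (X : PrintedCarriersR) : PrintedCarriersR :=
  carriers₂ θ.toStage2Params (withB6KOfRecord X θ)

/-- The B6 group of `carriers₃ θ X` IS the block of record (the B4 ∕ B5 ∕ B7 substitutions do not touch it; `rfl`).
[cite: Balaban1984PropagatorsII, pp.223–250, bookkeeping] -/
theorem carriers₃_D6 (θ : Stage3Params) (X : PrintedCarriersR) : (carriers₃ θ X).D6 = D6OfRecord θ := rfl

/-- **«`w` is a binding world of record, Stage 3»**: for some admissible `θ : Stage3Params`, at every run the upstream block is the N-binding over `carriers₃ θ X`.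
[cite: Balaban1984PropagatorsII, pp.223–250 (objects of record, Stage 3 dictionary)] -/
def IsWorldOfRecord₃ (w : WorldP) : Prop :=
  ∃ θ : Stage3Params, θ.toStage1Params.Admissible ∧ ∀ P : B12.RunParams,
    ∃ (X : PrintedCarriersR) (Y : PrintedCarriers9X) (Z : PrintedCarriers11) (V : PrintedCarriers14R) (W : PrintedCarriers15),
      w.up P = Upstream.ofPrintedAllXPN (carriers₃ θ X) Y Z V W

/-- **Refinement `IsWorldOfRecord₃ w → IsWorldOfRecord₂ w`** (witness `X ↦ withB6KOfRecord X θ`; `rfl`) — nodes discharged at Stages 1–2 stay discharged.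
[cite: Balaban1984PropagatorsII, pp.223–250 (bookkeeping)] -/
theorem isWorldOfRecord₂_of_isWorldOfRecord₃ (w : WorldP) (hw : IsWorldOfRecord₃ w) : IsWorldOfRecord₂ w := by
  obtain ⟨θ, hθ, hup⟩ := hw
  refine ⟨θ.toStage2Params, hθ, fun P => ?_⟩
  obtain ⟨X, Y, Z, V, W, hP⟩ := hup P
  exact ⟨withB6KOfRecord X θ, Y, Z, V, W, hP⟩

/-- The constant-binding worlds over `carriers₃ θ X` are worlds of record, Stage 3. [cite: Balaban1984PropagatorsII, pp.223–250 (bookkeeping)] -/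
theorem isWorldOfRecord₃_of_up (θ : Stage3Params) (hθ : θ.toStage1Params.Admissible) (X : PrintedCarriersR) (Y : PrintedCarriers9X)
    (Z : PrintedCarriers11) (V : PrintedCarriers14R) (W : PrintedCarriers15) (w : WorldP)
    (hw : w.up = fun _ => Upstream.ofPrintedAllXPN (carriers₃ θ X) Y Z V W) : IsWorldOfRecord₃ w :=
  ⟨θ, hθ, fun P => ⟨X, Y, Z, V, W, by rw [hw]⟩⟩

/-! ## §4. The DAG nodes at every world of record, Stage 3 -/

/-- **N03 · [Balaban1984PropagatorsII]: `Dag.B6_main (leavesP w P)` («b4 → b5 → b6») at every Stage-3 world of record, every run, MODULO THE BLOCK'S LEAF**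
`DagBinding.B6BlockParam (D6OfRecord θ)` at admissible `θ` (the antecedents b4, b5 are not used).  The displayed hypothesis is what dag-p1's discharge
module (`b6BlockParam_tower_of` with h21, h22, h24, h25 discharged) plus Prop. 2.6 hypothesis-free deliver.
[cite: Balaban1984PropagatorsII, Lemma 2.1 – Cor. 2.8 pp.234–249 (the stated block at the objects of record)] -/
theorem b6_main_of_isWorldOfRecord₃_of
    (hleaf : ∀ θ : Stage3Params, θ.toStage1Params.Admissible → B6BlockParam (D6OfRecord θ))
    (w : WorldP) (hw : IsWorldOfRecord₃ w) (P : B12.RunParams) : Dag.B6_main (leavesP w P) := by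
  obtain ⟨θ, hθ, hup⟩ := hw
  obtain ⟨X, Y, Z, V, W, hP⟩ := hup P
  intro _ _
  show (w.up P).b6
  rw [hP]
  exact hleaf θ hθ

/-- N04 at every Stage-3 world (through the refinement). [cite: Balaban1985Averaging, Props. 1–10 pp.26–50 (kernel version of the lit-balaban lineage)] -/
theorem b7_main_of_isWorldOfRecord₃ (w : WorldP) (hw : IsWorldOfRecord₃ w) (P : B12.RunParams) : Dag.B7_main (leavesP w P) :=
  b7_main_of_isWorldOfRecord₂ w (isWorldOfRecord₂_of_isWorldOfRecord₃ w hw) P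

/-- N01 at every Stage-3 world (through the refinements). [cite: Balaban1983RegularityDecay, Theorem p.573 (kernel version of the lit-balaban r01 lineage)] -/
theorem b4_main_of_isWorldOfRecord₃ (w : WorldP) (hw : IsWorldOfRecord₃ w) (P : B12.RunParams) : Dag.B4_main (leavesP w P) :=
  b4_main_of_isWorldOfRecord₂ w (isWorldOfRecord₂_of_isWorldOfRecord₃ w hw) P

/-- N02 at every Stage-3 world (through the refinements). [cite: Balaban1984PropagatorsI, Props. 1.1–1.2 pp.33–36 (kernel versions of the lit-balaban lineages)] -/
theorem b5_main_of_isWorldOfRecord₃ (w : WorldP) (hw : IsWorldOfRecord₃ w) (P : B12.RunParams) : Dag.B5_main (leavesP w P) :=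
  b5_main_of_isWorldOfRecord₂ w (isWorldOfRecord₂_of_isWorldOfRecord₃ w hw) P

end Literature.MathematicalPhysics.QuantumFieldTheory.Balaban1983to89.Node00

end
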